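import Summits.ResolutionOfSingularities.ResolutionOfSingularities.Theorems.DeltaCutRef2
import HarnessLib

/-!
# DeltaCutRef3 — decomp-res node «RefCut» (lens-6 g27, critic row 204 CLEARED (F-curve WHOLE) DECIDED +1 · MAP 0),
tree file 3/5 of the node

Content VERBATIM from the decomp-res lens-6 g27 node `HOME/decomp-res-lens-6/g27/RefCut.lean` (pin df7099b8; no
carry, imports the landed `DeltaCutSepCells` + Literature; namespace `…Theorems.DeltaCutClasses`); HOME =
run/shared/lean/pub/decomp-res; critic CRITIC-LEDGER row 204 CLEARED (F-curve WHOLE) DECIDED +1 · MAP 0; landing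
orders NEXT-g28.md §4 + INBOX :1315 (09:51:49Z) — provenance, critic text and the lens header in full in the first
file of the node, `DeltaCutRef`.  `--kind proof --supports stmt-ResolutionOfSingularities-26971`.

## This file

Continuation 3/4 of `DeltaCutRef` (same namespace / sections of the node, cut at the tree's 400-line cap; section
variables / opens replayed): scopes `RefSing`, `RefStrict`, `RefTower` — carries `singLocusOf_finite`,
`isClosed_singLocusOf`, `closure_singLocusOf_eq`, `coe_support_singCentreOf`, `isRegular_subscheme_singCentreOf`,
`singLocusOf_nonempty_of_not_reducedRegular`, `strictTransformIdeal_vanishingIdeal_eq_of_closeds`,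
`exists_resolveHom`, `PStage`, `presolve`, `presolveRun`, `presolveRun_zero`, `presolveRun_succ`, `PGood`,
`strictTransformIdeal_singCentreOf_eq`, `PGood.presolve`, `PGood.presolveRun`, `KLink`, `exists_kLink_presolve`,
`exists_chain_presolveRun`, `finite_compl_regularLocus`.

[WRITER NOTE (decomp-res writer g13): file split only (tree files ≤ 400 lines; the plan's section groups, cut
further by the cap at declaration boundaries); namespace, sections, section `open`s / `variable`s and every
declaration exactly as in the lens (the node's HOME-only dupNamespace-linter line is dropped — the library sets it;
`noncomputable section`, the two file-level `open` lines, `universe u` and the namespace-level `open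
…TwistCutClasses` / `open …LightCutClasses` of the node are replayed in every file).]

(Sources: Hironaka1964; Kollar2007 Thm. 1.101; Lipman1978 §1; CossartJannsenSaito2020 §5–§6, Def. 3.13 / Thm. 3.14;
CossartPiltant2019 Prop. 2.6; EGAIV2 §7.8; BierstoneGrigorievMilmanWlodarczyk2011 §3; Hironaka1967; Giraud1975.)
-/

noncomputable section

open CategoryTheory CategoryTheory.Limits AlgebraicGeometry TopologicalSpace IsLocalRing
open Literature.AlgebraicGeometry.Resolution

universe u

namespace Summit.ResolutionOfSingularities.ResolutionOfSingularities.Theorems.DeltaCutClasses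

open Summit.ResolutionOfSingularities.ResolutionOfSingularities.Theorems.TwistCutClasses
open Summit.ResolutionOfSingularities.ResolutionOfSingularities.Theorems.LightCutClasses

section RefSing

open Summit.ResolutionOfSingularities.ResolutionOfSingularities.Theorems
open WeakOrderReduction ForcedTowerClasses SubfieldContactClasses AbsoluteContactClasses PurityValveClasses
open Scheme.IdealSheafData (vanishingIdeal)

/-- **(S) · THE SINGULAR LOCUS OF A REDUCED CURVE ON A BASE SCHEME IS A FINITE SET OF CLOSED POINTS.**  For `Y` a base scheme
(of finite type over a field) and `S ⊆ Y` closed with `dim S_red ≤ 1`: `S_red` is reduced, Noetherian and quasi-excellent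
(`Stacks07QW_field_holds`), so its singular locus is CLOSED (J-2); every point of it is a specialisation of a
generic point of an
irreducible component, which is REGULAR (its local ring is a field, `S_red` being reduced), so the singular locus has dimension
`≤ 0`: it is FINITE and consists of CLOSED points (in `S_red`, hence in `Y`). [new] [folklore] -/
theorem singLocusOf_finite {k : Type} [Field k] {Y : Scheme.{0}} {g : Y ⟶ Spec (.of k)} (hB : IsBase Y g) (S : Closeds Y)
    (hdim : DimLEOne S) : (singLocusOf S).Finite ∧ ∀ y ∈ singLocusOf S, IsClosed ({y} : Set Y) := by
  haveI := isLocallyNoetherian_of_isBase hB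
  haveI := hB.locallyOfFiniteType
  haveI := hB.quasiCompact
  haveI : IsReduced (vanishingIdeal S).subscheme := isReduced_subscheme_vanishingIdeal S
  haveI : IsNoetherian (vanishingIdeal S).subscheme :=
    Scheme.isNoetherian_of_finiteType_over_field ((vanishingIdeal S).subschemeι ≫ g)
  have hqe : Scheme.IsQuasiExcellent (vanishingIdeal S).subscheme :=
    Scheme.isQuasiExcellent_of_locallyOfFiniteType Stacks07QW_field_holds ((vanishingIdeal S).subschemeι ≫ g)
  have hcl : IsClosed (Scheme.regularLocus (vanishingIdeal S).subscheme)ᶜ :=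
    (Scheme.isOpen_regularLocus_of_isQuasiExcellent hqe).isClosed_compl
  -- the singular locus has dimension `≤ 0`: each of its points specialises from a (regular) component generic point
  have h0 : topologicalKrullDim ((Scheme.regularLocus (vanishingIdeal S).subscheme)ᶜ : Set _) ≤ 0 := by
    have huniv : topologicalKrullDim (Set.univ : Set (vanishingIdeal S).subscheme) < ((1 + 1 : ℕ) : WithBot ℕ∞) := by
      refine lt_of_le_of_lt ((topologicalKrullDim_subspace_le _ Set.univ).trans hdim) ?_
      exact_mod_cast WithBot.coe_lt_coe.mpr (by decide)
    have hlt := Literature.Topology.topologicalKrullDim_lt_of_forall_exists_specializes isClosed_univ hcl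
      (Set.subset_univ _) (fun z hz => ?_) 1 huniv
    · have h1 : topologicalKrullDim ((Scheme.regularLocus (vanishingIdeal S).subscheme)ᶜ : Set _) < 1 := by exact_mod_cast hlt
      rw [← zero_add (1 : WithBot ℕ∞), ← Nat.cast_zero, ENat.WithBot.lt_add_one_iff] at h1
      rwa [← Nat.cast_zero]
    · -- the generic point of an irreducible component through `z`
      have hirr : IsIrreducible (irreducibleComponent z) := isIrreducible_irreducibleComponent
      refine ⟨hirr.genericPoint, Set.mem_univ _, fun hw => hw ?_, ?_⟩
      · change IsRegularLocalRing _
        have hF : IsField ((vanishingIdeal S).subscheme.presheaf.stalk hirr.genericPoint) := by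
          refine isField_stalk_of_closure_mem_irreducibleComponents _ hirr.genericPoint ?_
          rw [hirr.closure_genericPoint isClosed_irreducibleComponent]
          exact irreducibleComponent_mem_irreducibleComponents z
        letI := hF.toField
        infer_instance
      · exact (hirr.isGenericPoint_genericPoint isClosed_irreducibleComponent).specializes mem_irreducibleComponent
  have hfin : ((Scheme.regularLocus (vanishingIdeal S).subscheme)ᶜ).Finite := Set.finite_of_topologicalKrullDim_le_zero h0
  have hpt : ∀ c ∈ (Scheme.regularLocus (vanishingIdeal S).subscheme)ᶜ, IsClosed ({c} : Set (vanishingIdeal S).subscheme) :=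
    fun c hc => Literature.Topology.Set.isClosed_singleton_of_topologicalKrullDim_le_zero hcl h0 hc
  refine ⟨hfin.image _, ?_⟩
  rintro _ ⟨c, hc, rfl⟩
  rw [← Set.image_singleton]
  exact (vanishingIdeal S).subschemeι.isClosedEmbedding.isClosedMap _ (hpt c hc)

/-- the singular locus of a reduced curve on a base scheme is CLOSED (so the resolving centre is supported exactly on it).
[new] [folklore] -/
theorem isClosed_singLocusOf {k : Type} [Field k] {Y : Scheme.{0}} {g : Y ⟶ Spec (.of k)} (hB : IsBase Y g) (S : Closeds Y)
    (hdim : DimLEOne S) : IsClosed (singLocusOf S) := by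
  obtain ⟨hfin, hcl⟩ := singLocusOf_finite hB S hdim
  exact isClosed_of_finite_of_isClosed_singleton hfin hcl

/-- … hence its closure is itself. [folklore] -/
theorem closure_singLocusOf_eq {k : Type} [Field k] {Y : Scheme.{0}} {g : Y ⟶ Spec (.of k)} (hB : IsBase Y g) (S : Closeds Y)
    (hdim : DimLEOne S) : closure (singLocusOf S) = singLocusOf S := (isClosed_singLocusOf hB S hdim).closure_eq

/-- the resolving centre is supported exactly on the singular locus. [folklore] -/
theorem coe_support_singCentreOf {k : Type} [Field k] {Y : Scheme.{0}} {g : Y ⟶ Spec (.of k)} (hB : IsBase Y g)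
    (S : Closeds Y) (hdim : DimLEOne S) : ((singCentreOf S).support : Set Y) = singLocusOf S := by
  rw [singCentreOf, coe_support_vanishingIdeal]; exact closure_singLocusOf_eq hB S hdim

/-- **THE RESOLVING CENTRE IS A REGULAR SCHEME** (a finite set of closed points with its reduced structure,
`isRegular_subscheme_vanishingIdeal_finset`). [new] [folklore] -/
theorem isRegular_subscheme_singCentreOf {k : Type} [Field k] {Y : Scheme.{0}} {g : Y ⟶ Spec (.of k)} (hB : IsBase Y g)
    (S : Closeds Y) (hdim : DimLEOne S) : Scheme.IsRegular (singCentreOf S).subscheme := by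
  haveI := isLocallyNoetherian_of_isBase hB
  obtain ⟨hfin, hcl⟩ := singLocusOf_finite hB S hdim
  have hc2 : IsClosed ((hfin.toFinset : Set Y)) := by rw [Set.Finite.coe_toFinset]; exact isClosed_singLocusOf hB S hdim
  have heq : (⟨closure (singLocusOf S), isClosed_closure⟩ : Closeds Y) = ⟨(hfin.toFinset : Set Y), hc2⟩ :=
    Closeds.ext (by
      show closure (singLocusOf S) = (hfin.toFinset : Set Y)
      rw [Set.Finite.coe_toFinset]; exact closure_singLocusOf_eq hB S hdim)
  rw [singCentreOf, heq]
  exact isRegular_subscheme_vanishingIdeal_finset hfin.toFinset (fun y hy => hcl y (hfin.mem_toFinset.mp hy)) _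

/-- an IRREGULAR `S_red` has a NONEMPTY singular locus. [folklore] -/
theorem singLocusOf_nonempty_of_not_reducedRegular {Y : Scheme.{0}} {S : Closeds Y} (h : ¬ ReducedRegular S) :
    (singLocusOf S).Nonempty := by
  rw [reducedRegular_iff_singLocusOf_eq_empty] at h
  exact Set.nonempty_iff_ne_empty.mpr h

end RefSing

section RefStrict

open Summit.ResolutionOfSingularities.ResolutionOfSingularities.Theorems
open WeakOrderReduction ForcedTowerClasses SubfieldContactClasses AbsoluteContactClasses PurityValveClasses
open Scheme.IdealSheafData (vanishingIdeal)

/-! ### §RefStrict — THE RESOLVING HOP RESTRICTED TO THE PENDING CURVE IS A POINT BLOW-UP OF THE REDUCED CURVE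
(tree currency: Stacks Tag 080E `isBlowup_lift_subschemeι_strictTransformIdeal`, reducedness of blow-ups
`IsBlowup.isReduced_of_isReduced`, `support_strictTransformIdeal_eq_closure`, `stalkIdeal_vanishingIdeal_of_finite`,
`IsBlowup.isIso_stalkMap_of_not_mem_support`) -/

/-- **`σ(𝓘_S) = 𝓘(closure π⁻¹(S ∖ Z))` FOR EVERY CLOSED `S`** (the reduced, not-necessarily-irreducible form of the tree's
`strictTransformIdeal_vanishingIdeal_eq`): along a blow-up `π` of a locally Noetherian scheme in the reduced centre `𝓘(Z)`,
the schematic strict transform of `𝓘(S)` is REDUCED — `V(σ𝓘_S)` is the blow-up of the reduced scheme `S_red` in the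
restricted centre (Tag 080E), hence reduced — so it is the ideal of its support, the topological strict transform.
[new] [folklore] (Sources: StacksProject, Tag 080E.) -/
theorem strictTransformIdeal_vanishingIdeal_eq_of_closeds {X X' : Scheme.{0}} [IsLocallyNoetherian X]
    [IsLocallyNoetherian X'] {π : X' ⟶ X} (Z : Closeds X) (hπ : IsBlowup π (vanishingIdeal Z)) (S : Closeds X) :
    strictTransformIdeal π (vanishingIdeal Z) (vanishingIdeal S) =
      vanishingIdeal ⟨closure (π.base ⁻¹' ((S : Set X) \ (Z : Set X))), isClosed_closure⟩ := by
  have hρ := isBlowup_lift_subschemeι_strictTransformIdeal hπ (vanishingIdeal S).subschemeι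
  haveI : IsReduced (vanishingIdeal S).subscheme := isReduced_subscheme_vanishingIdeal S
  haveI : IsLocallyNoetherian (vanishingIdeal S).subscheme :=
    LocallyOfFiniteType.isLocallyNoetherian (vanishingIdeal S).subschemeι
  haveI : IsReduced (strictTransformIdeal π (vanishingIdeal Z) (vanishingIdeal S).subschemeι.ker).subscheme :=
    hρ.isReduced_of_isReduced
  have hrad := radical_eq_of_isReduced_subscheme (strictTransformIdeal π (vanishingIdeal Z) (vanishingIdeal S).subschemeι.ker)
  rw [Scheme.IdealSheafData.ker_subschemeι] at hrad
  rw [← hrad, ← Scheme.IdealSheafData.vanishingIdeal_support]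
  congr 1
  ext1
  rw [support_strictTransformIdeal_eq_closure, coe_support_vanishingIdeal, coe_support_vanishingIdeal]
  rfl

/-- **THE RESOLVING HOP ON THE PENDING CURVE (one step of the Kollár chain).**  Let `S ⊆ X` be closed, `Z =
Sing(S_red)` a finite
closed set of closed points, `π` a blow-up in `𝓘(Z)` and `K = σ(𝓘_S)`.  Then `V(K) → S_red` is a blow-up of `S_red` in the
pulled-back centre `ι^*𝓘(Z)` (Tag 080E), and EVERY SINGULAR POINT `c'` of `V(K)` lies over a SINGULAR point `c` of
`S_red` at which
the pulled-back centre has stalk `𝔪_c` (off `Z` the stalk map is an isomorphism, so `c'` would be regular).  This is exactly one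
link `(𝒪_{S_red,c}, 𝒪_{V(K),c'})` of a chain as in `Kollar2007_thm_1_101_localChain`. [new] [folklore] -/
theorem exists_resolveHom {X X' : Scheme.{0}} [IsLocallyNoetherian X] [IsLocallyNoetherian X'] {π : X' ⟶ X}
    (S Zc : Closeds X) (hZ : (Zc : Set X) = singLocusOf S) (hfin : (Zc : Set X).Finite)
    (hcl : ∀ z ∈ (Zc : Set X), IsClosed ({z} : Set X)) (hπ : IsBlowup π (vanishingIdeal Zc))
    {K : X'.IdealSheafData} (hK : strictTransformIdeal π (vanishingIdeal Zc) (vanishingIdeal S) = K) :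
    ∃ ρ : K.subscheme ⟶ (vanishingIdeal S).subscheme,
      IsBlowup ρ ((vanishingIdeal Zc).comap (vanishingIdeal S).subschemeι) ∧
      ∀ c' : K.subscheme, c' ∉ Scheme.regularLocus K.subscheme →
        ρ.base c' ∉ Scheme.regularLocus (vanishingIdeal S).subscheme ∧
        stalkIdeal ((vanishingIdeal Zc).comap (vanishingIdeal S).subschemeι) (ρ.base c') =
          maximalIdeal ((vanishingIdeal S).subscheme.presheaf.stalk (ρ.base c')) := by
  subst hK
  have key : ∃ ρ : (strictTransformIdeal π (vanishingIdeal Zc) (vanishingIdeal S).subschemeι.ker).subscheme ⟶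
      (vanishingIdeal S).subscheme, IsBlowup ρ ((vanishingIdeal Zc).comap (vanishingIdeal S).subschemeι) :=
    ⟨_, isBlowup_lift_subschemeι_strictTransformIdeal hπ (vanishingIdeal S).subschemeι⟩
  rw [Scheme.IdealSheafData.ker_subschemeι] at key
  obtain ⟨ρ, hρ⟩ := key
  refine ⟨ρ, hρ, fun c' hc' => ?_⟩
  -- the image point lies ON the centre: off the centre the stalk map is an isomorphism
  have hmem : (vanishingIdeal S).subschemeι.base (ρ.base c') ∈ (Zc : Set X) := by
    by_contra hno
    have hns : ρ.base c' ∉ ((((vanishingIdeal Zc).comap (vanishingIdeal S).subschemeι).support :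
        Set (vanishingIdeal S).subscheme)) := by
      rw [Scheme.IdealSheafData.support_comap, Closeds.coe_preimage, coe_support_vanishingIdeal]; exact hno
    haveI := hρ.isIso_stalkMap_of_not_mem_support hns
    have hc : ρ.base c' ∈ Scheme.regularLocus (vanishingIdeal S).subscheme := by
      by_contra h
      apply hno
      rw [hZ]
      exact (mem_singLocusOf_iff S (ρ.base c')).mpr h
    apply hc'
    change IsRegularLocalRing _ at hc
    change IsRegularLocalRing _
    exact IsRegularLocalRing.of_ringEquiv (asIso (ρ.stalkMap c')).commRingCatIsoToRingEquiv
  refine ⟨fun h => ?_, ?_⟩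
  · have h' : (vanishingIdeal S).subschemeι.base (ρ.base c') ∈ singLocusOf S := by rw [← hZ]; exact hmem
    exact ((mem_singLocusOf_iff S (ρ.base c')).mp h') h
  · rw [stalkIdeal_comap_eq_map_stalkMap]
    erw [stalkIdeal_vanishingIdeal_of_finite hfin hcl hmem]
    exact IsLocalRing.map_maximalIdeal_of_surjective _ ((vanishingIdeal S).subschemeι.stalkMap_surjective _)

end RefStrict

section RefTower

open Summit.ResolutionOfSingularities.ResolutionOfSingularities.Theorems
open WeakOrderReduction ForcedTowerClasses SubfieldContactClasses AbsoluteContactClasses PurityValveClasses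
open Scheme.IdealSheafData (vanishingIdeal)

/-! ### §RefTower — (T) THE PENDING PHASE IS FINITE: iterating «blow up Sing(S_red), pass to the strict transform» reaches a
REGULAR strict transform after finitely many steps (Kollár 2007 Thm. 1.101, tree THEOREM
`Kollar2007_thm_1_101_localChain_holds`,
applied to the local ring of `S_red` at a singular point: reduced, essentially of finite type over a field, so with reduced
completion — `IsQuasiExcellentRing.isReduced_adicCompletion_iff` + `Stacks07QW_field_holds`). -/

/-- a stage together with a PENDING closed subset (the pure resolving tower lives on these). -/
structure PStage where
  /-- the stage -/
  N : Stage
  /-- the pending closed subset of its scheme -/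
  S : Closeds N.Y

/-- one step of the pure resolving tower: blow up `Sing(S_red)`, carry the strict transform of `S`. -/
def presolve (n : ℕ) (P : PStage) : PStage := ⟨resolveStage n P.N P.S, strictClosure P.S⟩

/-- the pure resolving tower. -/
def presolveRun (n : ℕ) (P : PStage) : ℕ → PStage := fun t => Nat.rec P (fun _ Q => presolve n Q) t

/-- `presolveRun_zero`: Auxiliary step of this node's calculus, VERBATIM from the lens file (see the module
docstring); the statement is its type. [folklore] -/
@[simp] theorem presolveRun_zero (n : ℕ) (P : PStage) : presolveRun n P 0 = P := rfl

/-- `presolveRun_succ`: Auxiliary step of this node's calculus, VERBATIM from the lens file (see the module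
docstring); the statement is its type. [folklore] -/
@[simp] theorem presolveRun_succ (n : ℕ) (P : PStage) (t : ℕ) :
    presolveRun n P (t + 1) = presolve n (presolveRun n P t) := rfl

/-- the invariant of the pure tower: the scheme is a base scheme over `k` and the pending set is a curve (or less). -/
def PGood (k : Type) [Field k] (P : PStage) : Prop :=
  (∃ g : P.N.Y ⟶ Spec (.of k), IsBase P.N.Y g) ∧ DimLEOne P.S

/-- the strict-transform identity specialised to the resolving hop: `σ(𝓘_S) = 𝓘(strictClosure S)`. [folklore] -/
theorem strictTransformIdeal_singCentreOf_eq {k : Type} [Field k] {Y : Scheme.{0}} {g : Y ⟶ Spec (.of k)} (hB : IsBase Y g)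
    {I : Y.IdealSheafData} (S : Closeds Y) :
    haveI := isLocallyNoetherian_of_isBase hB
    haveI : IsLocallyNoetherian (blowup (singCentreOf S)) :=
      @LocallyOfFiniteType.isLocallyNoetherian _ _ (blowup.π (singCentreOf S))
        (@IsProper.toLocallyOfFiniteType _ _ _ (blowup.isBlowup (singCentreOf S)).isProper) _
    strictTransformIdeal (blowup.π (singCentreOf S)) (singCentreOf S) (vanishingIdeal S) =
      vanishingIdeal (strictClosure (N := ⟨Y, I⟩) S) := by
  haveI := isLocallyNoetherian_of_isBase hB
  haveI : IsProper (blowup.π (singCentreOf S)) := (blowup.isBlowup (singCentreOf S)).isProper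
  haveI : IsLocallyNoetherian (blowup (singCentreOf S)) := LocallyOfFiniteType.isLocallyNoetherian (blowup.π (singCentreOf S))
  exact strictTransformIdeal_vanishingIdeal_eq_of_closeds _ (blowup.isBlowup (singCentreOf S)) S

/-- **THE INVARIANT PROPAGATES** along the resolving step: the new scheme is a base scheme (`baseStable_holds`, the centre being
regular by (S)) and the strict transform of the pending curve is again of dimension `≤ 1` (it is a blow-up of `S_red`,
`IsBlowup.topologicalKrullDim_le_of_isLocallyNoetherian`). [new] [folklore] -/
theorem PGood.presolve {k : Type} [Field k] {n : ℕ} {P : PStage} (hP : PGood k P) : PGood k (presolve n P) := by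
  obtain ⟨⟨g, hB⟩, hdim⟩ := hP
  haveI := isLocallyNoetherian_of_isBase hB
  have hCreg := isRegular_subscheme_singCentreOf hB P.S hdim
  have hB₁ : IsBase (blowup (singCentreOf P.S)) (blowup.π (singCentreOf P.S) ≫ g) := baseStable_holds k _ g hB _ hCreg
  haveI := isLocallyNoetherian_of_isBase hB₁
  refine ⟨⟨_, hB₁⟩, ?_⟩
  obtain ⟨hfin, hcl⟩ := singLocusOf_finite hB P.S hdim
  have hZ : ((⟨closure (singLocusOf P.S), isClosed_closure⟩ : Closeds P.N.Y) : Set P.N.Y) = singLocusOf P.S :=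
    closure_singLocusOf_eq hB P.S hdim
  have hK := strictTransformIdeal_singCentreOf_eq hB (I := P.N.I) P.S
  obtain ⟨ρ, hρ, -⟩ := exists_resolveHom P.S _ hZ (by rw [hZ]; exact hfin) (by rw [hZ]; exact hcl)
    (blowup.isBlowup (singCentreOf P.S)) hK
  haveI : IsLocallyNoetherian (vanishingIdeal P.S).subscheme :=
    LocallyOfFiniteType.isLocallyNoetherian (vanishingIdeal P.S).subschemeι
  exact hρ.topologicalKrullDim_le_of_isLocallyNoetherian hdim

/-- … hence along the whole pure tower. [folklore] -/
theorem PGood.presolveRun {k : Type} [Field k] {n : ℕ} {P : PStage} (hP : PGood k P) : ∀ t, PGood k (presolveRun n P t)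
  | 0 => hP
  | t + 1 => (PGood.presolveRun hP t).presolve

/-- one LINK of a Kollár chain (the shape of the hypothesis of `Kollar2007_thm_1_101_localChain`). -/
def KLink (r r' : CommRingCat.{0}) : Prop :=
  ∃ (X X' : Scheme.{0}) (π : X' ⟶ X) (D : X.IdealSheafData) (x : X) (x' : X'),
    IsBlowup π D ∧ stalkIdeal D x = maximalIdeal (X.presheaf.stalk x) ∧ π.base x' = x ∧
      Nonempty (X.presheaf.stalk x ≅ r) ∧ Nonempty (X'.presheaf.stalk x' ≅ r')

/-- **ONE STEP OF THE CHAIN**: a singular point of the strict transform lies over a singular point of the pending curve, linked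
by a blow-up in a centre with stalk `𝔪`. [new] [folklore] -/
theorem exists_kLink_presolve {k : Type} [Field k] {n : ℕ} {P : PStage} (hP : PGood k P)
    (c' : (vanishingIdeal (presolve n P).S).subscheme)
    (hc' : c' ∉ Scheme.regularLocus (vanishingIdeal (presolve n P).S).subscheme) :
    ∃ c : (vanishingIdeal P.S).subscheme, c ∉ Scheme.regularLocus (vanishingIdeal P.S).subscheme ∧
      KLink ((vanishingIdeal P.S).subscheme.presheaf.stalk c) ((vanishingIdeal (presolve n P).S).subscheme.presheaf.stalk c') := by
  obtain ⟨⟨g, hB⟩, hdim⟩ := hP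
  haveI := isLocallyNoetherian_of_isBase hB
  have hCreg := isRegular_subscheme_singCentreOf hB P.S hdim
  haveI := isLocallyNoetherian_of_isBase (baseStable_holds k _ g hB _ hCreg)
  obtain ⟨hfin, hcl⟩ := singLocusOf_finite hB P.S hdim
  have hZ : ((⟨closure (singLocusOf P.S), isClosed_closure⟩ : Closeds P.N.Y) : Set P.N.Y) = singLocusOf P.S :=
    closure_singLocusOf_eq hB P.S hdim
  have hK := strictTransformIdeal_singCentreOf_eq hB (I := P.N.I) P.S
  obtain ⟨ρ, hρ, hsing⟩ := exists_resolveHom P.S _ hZ (by rw [hZ]; exact hfin) (by rw [hZ]; exact hcl)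
    (blowup.isBlowup (singCentreOf P.S)) hK
  obtain ⟨hc, hst⟩ := hsing c' hc'
  exact ⟨ρ.base c', hc, _, _, ρ, _, ρ.base c', c', hρ, hst, rfl, ⟨Iso.refl _⟩, ⟨Iso.refl _⟩⟩

/-- **THE KOLLÁR CHAIN BELOW A SINGULAR POINT OF LEVEL `L`**: a singular point `c'` of the `L`-th strict transform lies at the
top of a chain `R₀, …, R_L` of NON-REGULAR local rings starting at the local ring of a singular point `c` of `S_red`, each
consecutive pair linked by a blow-up in a centre with stalk `𝔪` (induction on `L`, `exists_kLink_presolve`). [new] [folklore] -/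
theorem exists_chain_presolveRun {k : Type} [Field k] {n : ℕ} {P : PStage} (hP : PGood k P) : ∀ (L : ℕ)
    (c' : (vanishingIdeal (presolveRun n P L).S).subscheme),
      c' ∉ Scheme.regularLocus (vanishingIdeal (presolveRun n P L).S).subscheme →
      ∃ (c : (vanishingIdeal P.S).subscheme) (R : ℕ → CommRingCat.{0}),
        c ∉ Scheme.regularLocus (vanishingIdeal P.S).subscheme ∧
        R 0 = (vanishingIdeal P.S).subscheme.presheaf.stalk c ∧
        R L = (vanishingIdeal (presolveRun n P L).S).subscheme.presheaf.stalk c' ∧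
        (∀ t < L, KLink (R t) (R (t + 1))) ∧ ∀ t ≤ L, ¬ IsRegularLocalRing (R t)
  | 0, c', hc' => ⟨c', fun _ => (vanishingIdeal P.S).subscheme.presheaf.stalk c', hc', rfl, rfl,
      fun t ht => absurd ht (Nat.not_lt_zero t), fun t _ => hc'⟩
  | L + 1, c'', hc'' => by
    obtain ⟨c', hc', hlink⟩ := exists_kLink_presolve (hP.presolveRun L) c'' hc''
    obtain ⟨c, R, hc, hR0, hRL, hlinks, hnreg⟩ := exists_chain_presolveRun hP L c' hc'
    refine ⟨c, fun t => if t ≤ L then R t else (vanishingIdeal (presolveRun n P (L + 1)).S).subscheme.presheaf.stalk c'',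
      hc, ?_, ?_, ?_, ?_⟩
    · show (if 0 ≤ L then R 0 else _) = _
      rw [if_pos (Nat.zero_le L)]; exact hR0
    · show (if L + 1 ≤ L then R (L + 1) else _) = _
      rw [if_neg (by omega)]
    · intro t ht
      show KLink (if t ≤ L then R t else _) (if t + 1 ≤ L then R (t + 1) else _)
      rcases Nat.lt_succ_iff_lt_or_eq.mp ht with hlt | rfl
      · rw [if_pos hlt.le, if_pos (Nat.succ_le_of_lt hlt)]; exact hlinks t hlt
      · rw [if_pos le_rfl, if_neg (by omega), hRL]; exact hlink
    · intro t ht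
      show ¬ IsRegularLocalRing ↑(if t ≤ L then R t else _)
      rcases Nat.lt_succ_iff_lt_or_eq.mp (Nat.lt_succ_of_le ht) with hlt | rfl
      · rw [if_pos (Nat.lt_succ_iff.mp hlt)]; exact hnreg t (Nat.lt_succ_iff.mp hlt)
      · rw [if_neg (by omega)]; exact hc''

/-- the set of NON-REGULAR points of the reduced pending curve is finite ((S), pulled back along the closed
immersion). [folklore] -/
theorem finite_compl_regularLocus {k : Type} [Field k] {Y : Scheme.{0}} {g : Y ⟶ Spec (.of k)} (hB : IsBase Y g)
    (S : Closeds Y) (hdim : DimLEOne S) : ((Scheme.regularLocus (vanishingIdeal S).subscheme)ᶜ).Finite := by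
  obtain ⟨hfin, -⟩ := singLocusOf_finite hB S hdim
  refine (hfin.preimage (Set.injOn_of_injective (vanishingIdeal S).subschemeι.isClosedEmbedding.injective)).subset ?_
  intro c hc
  exact ⟨c, hc, rfl⟩

end RefTower

end Summit.ResolutionOfSingularities.ResolutionOfSingularities.Theorems.DeltaCutClasses
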